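import Literature.MathematicalPhysics.QuantumFieldTheory.Balaban1983to89.B4Thm112RegionLpHolder
import Literature.MathematicalPhysics.QuantumFieldTheory.Balaban1983to89.B4Thm112RegionLpDeriv
import Literature.MathematicalPhysics.QuantumFieldTheory.Balaban1983to89.B4Thm19RegionLpAll

/-!
# `Balaban1983to89.B4Thm112RegionLpHolderAll` — [Balaban1983RegularityDecay] THEOREM p. 573, (1.11)–(1.12): THE δG
# CLAUSE, HÖLDER MEMBER, FOR A GENERAL PAIR `Ω ⊂ Ω₀` UNDER `R₀`, ALL PAIRS `x ≠ x′` — close pairs by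
# `B4Thm112RegionLpHolder.thm112_holder_region`, far pairs by the derivative member
# `B4Thm112RegionLpDeriv.thm112_deriv_region` at `x` and at `x′` (as `B4Thm19RegionLpAll` for (1.9))

statement-level skeleton of published theorems with citation tags; proofs where landed; nothing here is a claim about the Yang–Mills mass gap

WHAT THIS FILE DOES.  **`thm112_holder_region_all`**: for every `α < 1` a cube size `K = K₁K₂` (`K₁` of the close-pair
theorem, `K₂` of the derivative member) and `c₀ > 0` with the Hölder δG inequality for ALL pairs `x ≠ x′` in `Ω` (both
forward bonds in `Ω`), under `R₀` at `x` and at `x′` (radius `K(d+4)`), for `f` on the sites of `Ω₀` supported in `P`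
with the separations `D` (from `x` and from `x′`), `D₀` (from `x` and from `x′` to `Ω^c`), `D₁` (`P` to `Ω^c`),
`0 ≤ D + D₀ + D₁`: close pairs `32|x−x′|_∞ ≤ ηM₁` are `thm112_holder_region`; for far pairs the weight
`(η^{-1}/|x−x′|_∞)^α ≤ 2` and `U(D^ηu_Ω)(x′) − (D^ηu_Ω)(x) − (U(D^ηu₀)(x′) − (D^ηu₀)(x)) = U((D^ηu_Ω − D^ηu₀)(x′)) − (D^ηu_Ω − D^ηu₀)(x)`
is bounded by the derivative δG member at `x′` (through the orthogonal transport, row sums `≤ N`) and at `x`.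
§2 the three δG members for `f` supported in one unit block `B(y₀)` of `Ω₀` (`‖f‖_{2,η} ≤ √N‖f‖_∞`,
`B4Thm110RegionLp.lpv_two_le_unitBlock`): `thm112_value_region_unitBlock`, `thm112_deriv_region_unitBlock`,
`thm112_holder_region_all_unitBlock`.

HONEST SCOPE.  As `B4Thm112RegionLpHolder` / `B4Thm112RegionLpDeriv`.  No `Prop` fact, no `sorry`; axioms standard.
-/

namespace Literature.MathematicalPhysics.QuantumFieldTheory.Balaban1983to89.B4Thm112RegionLpHolderAll

open Literature.MathematicalPhysics.QuantumFieldTheory.Balaban1983to89.B4Reflection242 (blk)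
open Literature.MathematicalPhysics.QuantumFieldTheory.Balaban1983to89.B4GaugeCovariance
open Literature.MathematicalPhysics.QuantumFieldTheory.Balaban1983to89.B4Lower18 (fineDom mem_fineDom IsBlockUnion)
open Literature.MathematicalPhysics.QuantumFieldTheory.Balaban1983to89.B4Lower18Regular (e1)
open Literature.MathematicalPhysics.QuantumFieldTheory.Balaban1983to89.B4Lower18RegularRegion (compField)
open Literature.MathematicalPhysics.QuantumFieldTheory.Balaban1983to89.B4Lemma21Region (regionOp regionDeriv)
open Literature.MathematicalPhysics.QuantumFieldTheory.Balaban1983to89.B4Lemma22EtaBox (vol vol_pos)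
open Literature.MathematicalPhysics.QuantumFieldTheory.Balaban1983to89.B4Eq221L2FactorRegion (acBond)
open Literature.MathematicalPhysics.QuantumFieldTheory.Balaban1983to89.B4WalkRouteRegion (rpos)
open Literature.MathematicalPhysics.QuantumFieldTheory.Balaban1983to89.B4RegionCubeCarrier
open Literature.MathematicalPhysics.QuantumFieldTheory.Balaban1983to89.B4Ineq110LpChain (lpv)
open Literature.MathematicalPhysics.QuantumFieldTheory.Balaban1983to89.B4ContourShift (supNorm supNorm_nonneg)
open Literature.MathematicalPhysics.QuantumFieldTheory.Balaban1983to89.B4Lemma22HolderBox (IsNNChain transport_fieldLink)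
open Literature.MathematicalPhysics.QuantumFieldTheory.Balaban1983to89.B4HolderChainTools (one_le_supNorm_of_ne)
open Literature.MathematicalPhysics.QuantumFieldTheory.Balaban1983to89.B4Thm19BoxHolderAll (rpow_le_max_one abs_U_mulVec_apply_le)
open Literature.MathematicalPhysics.QuantumFieldTheory.Balaban1983to89.B4Thm19RegionLpAll (isBlockUnion_of_mul)
open Literature.MathematicalPhysics.QuantumFieldTheory.Balaban1983to89.B4Thm110RegionLp (lpv_two_le_unitBlock)
open Literature.MathematicalPhysics.QuantumFieldTheory.Balaban1983to89.B4Thm112RegionLp (thm112_value_region)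
open Literature.MathematicalPhysics.QuantumFieldTheory.Balaban1983to89.B4Thm112RegionLpDeriv (thm112_deriv_region)
open Literature.MathematicalPhysics.QuantumFieldTheory.Balaban1983to89.B4Thm112RegionLpHolder (thm112_holder_region)
open scoped Matrix

noncomputable section

variable {d : ℕ} {ι : Type} [Fintype ι] [DecidableEq ι]

/-- **[B4] THEOREM p. 573, (1.11)–(1.12) — THE δG CLAUSE, HÖLDER MEMBER, GENERAL PAIR `Ω ⊂ Ω₀` UNDER `R₀`, ALL PAIRS
`x ≠ x′`, η-UNIFORM, HYPOTHESIS-FREE** (close pairs `32|x−x′|_∞ ≤ ηM₁`: `B4Thm112RegionLpHolder.thm112_holder_region`;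
far pairs: the Hölder weight is `≤ 2` and the quotient is bounded by the derivative member
`B4Thm112RegionLpDeriv.thm112_deriv_region` at `x′` (through the orthogonal transport) and at `x`).  For every `α < 1`
there are `K ≥ 16` (`8 ∣ K`) and `c₀ > 0` such that for every `(c, β)`, `β > 0`, there is `e₁ > 0` with: for every step
`k ≥ 1`, `a ∈ [a₋, a₊]`, `0 ≤ m² ≤ m₊²`, every pair `Ω ⊆ Ω₀` of finite unions of `K`-blocks, every `A` regular (1.7)
on `Ω₀` with `0 < e ≤ e₁`, every `μ`, every pair `x ≠ x′` in `Ω` with `x + e_μ, x′ + e_μ ∈ Ω`, every nearest-neighbour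
contour `Γ = (x, l)` in `Ω` to `x′` of length `≤ (d+1)|x−x′|_∞` within `|x−x′|_∞` of `x`, `R₀` at `x` and at `x′`
(radius `K(d+4)`), every `f : Ω₀ → ℝ^N` supported in `P` with `D ≤ dist_∞(x, P), dist_∞(x′, P)`,
`D₀ ≤ dist_∞(x, Ω^c), dist_∞(x′, Ω^c)`, `D₁ ≤ dist_∞(P, Ω^c)`, `0 ≤ D + D₀ + D₁`, `‖f‖_{2,η} ≤ V‖f‖_∞`, every colour:
`(η^{-1}/|x−x′|_∞)^α·|(U(D^η_{A,μ}u_Ω)(x′) − (D^η_{A,μ}u_Ω)(x) − (U(D^η_{A,μ}u₀)(x′) − (D^η_{A,μ}u₀)(x)))_i| ≤ c₀·V·exp(−(D+D₀+D₁)/(2nK))·‖f‖_∞`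
(`u_Ω = G_k(Ω,A)(f|_Ω)`, `u₀ = G_k(Ω₀,A)f`).
[cite: Balaban1983RegularityDecay, Theorem p.573 (1.9)–(1.12); (1.3)–(1.4) p.572; §2 pp.575–579] -/
theorem thm112_holder_region_all (F : OrthFlow ι) {ℓ₁ : ℝ} (hℓ₁ : 0 ≤ ℓ₁)
    (hLip : ∀ t (v : ι → ℝ), ((F.U t - 1) *ᵥ v) ⬝ᵥ ((F.U t - 1) *ᵥ v) ≤ (ℓ₁ * t) ^ 2 * (v ⬝ᵥ v))
    (d ℓ : ℕ) (hℓ : 1 ≤ ℓ) (amin aplus m2plus : ℝ) (ha : 0 < amin) (α : ℝ) (hα0 : 0 ≤ α) (hα1 : α < 1) :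
    ∃ K : ℕ, 16 ≤ K ∧ 8 ∣ K ∧ ∃ c₀ : ℝ, 0 < c₀ ∧ ∀ (creg β : ℝ), 0 ≤ creg → 0 < β →
      ∃ e₁ : ℝ, 0 < e₁ ∧ ∀ (k : ℕ), 1 ≤ k → ∀ (hn : 1 ≤ (ℓ + 1) ^ k) (a m2 : ℝ),
      amin ≤ a → a ≤ aplus → 0 ≤ m2 → m2 ≤ m2plus →
      ∀ (Ω₀c Ωc : Finset (Fin (d + 1) → ℤ)), IsBlockUnion K Ω₀c → IsBlockUnion K Ωc → ∀ (hsub : Ωc ⊆ Ω₀c)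
      (Ac : (Fin (d + 1) → ℤ) → Fin (d + 1) → ℝ) (e : ℝ), 0 < e → e ≤ e₁ →
        (∀ x ∈ fineDom ((ℓ + 1) ^ k) Ω₀c, ∀ μ ν : Fin (d + 1),
          |Ac (x + e1 μ) ν - Ac x ν| ≤ creg * e ^ (β - 1) / ((ℓ + 1) ^ k : ℕ)) →
      ∀ (μ : Fin (d + 1)) (x x' : ↥(fineDom ((ℓ + 1) ^ k) Ωc)), x.1 + e1 μ ∈ fineDom ((ℓ + 1) ^ k) Ωc →
        x'.1 + e1 μ ∈ fineDom ((ℓ + 1) ^ k) Ωc → x'.1 ≠ x.1 →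
      ∀ (l : List ↥(fineDom ((ℓ + 1) ^ k) Ωc)), IsNNChain x l → pathEnd x l = x' →
        (l.length : ℝ) ≤ ((d : ℝ) + 1) * supNorm (x'.1 - x.1) →
        (∀ z ∈ l, supNorm (z.1 - x.1) ≤ supNorm (x'.1 - x.1)) →
        (∀ y : Fin (d + 1) → ℤ, (∀ ν, |y ν - blk ((ℓ + 1) ^ k) x.1 ν| ≤ (K : ℤ) * (d + 4)) → y ∈ Ωc) →
        (∀ y : Fin (d + 1) → ℤ, (∀ ν, |y ν - blk ((ℓ + 1) ^ k) x'.1 ν| ≤ (K : ℤ) * (d + 4)) → y ∈ Ωc) →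
      ∀ (P : ↥(fineDom ((ℓ + 1) ^ k) Ω₀c) → Prop) [DecidablePred P] (D D₀ D₁ : ℝ), 0 ≤ D + D₀ + D₁ →
        (∀ x'', P x'' → ∃ ν, D ≤ |rpos ((ℓ + 1) ^ k) Ω₀c (incl hn hsub x) ν - rpos ((ℓ + 1) ^ k) Ω₀c x'' ν|) →
        (∀ x'', P x'' → ∃ ν, D ≤ |rpos ((ℓ + 1) ^ k) Ω₀c (incl hn hsub x') ν - rpos ((ℓ + 1) ^ k) Ω₀c x'' ν|) →
        (∀ x₁ : ↥(fineDom ((ℓ + 1) ^ k) Ω₀c), ¬ inReg ((ℓ + 1) ^ k) Ωc x₁ →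
          ∃ ν, D₀ ≤ |rpos ((ℓ + 1) ^ k) Ω₀c (incl hn hsub x) ν - rpos ((ℓ + 1) ^ k) Ω₀c x₁ ν|) →
        (∀ x₁ : ↥(fineDom ((ℓ + 1) ^ k) Ω₀c), ¬ inReg ((ℓ + 1) ^ k) Ωc x₁ →
          ∃ ν, D₀ ≤ |rpos ((ℓ + 1) ^ k) Ω₀c (incl hn hsub x') ν - rpos ((ℓ + 1) ^ k) Ω₀c x₁ ν|) →
        (∀ x'', P x'' → ∀ x₁ : ↥(fineDom ((ℓ + 1) ^ k) Ω₀c), ¬ inReg ((ℓ + 1) ^ k) Ωc x₁ →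
          ∃ ν, D₁ ≤ |rpos ((ℓ + 1) ^ k) Ω₀c x₁ ν - rpos ((ℓ + 1) ^ k) Ω₀c x'' ν|) →
      ∀ (f : ↥(fineDom ((ℓ + 1) ^ k) Ω₀c) × ι → ℝ), (∀ p, ¬ P p.1 → f p = 0) →
      ∀ (V : ℝ), 1 ≤ V → lpv (vol d ℓ k)⁻¹ 2 f ≤ V * ‖f‖ →
      ∀ i : ι,
        ((((ℓ + 1) ^ k : ℕ) : ℝ) / supNorm (x'.1 - x.1)) ^ α *
          |(transport (fieldLink F (e / ((ℓ + 1) ^ k : ℕ)) (acBond Ωc Ac)) x l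
              *ᵥ fld (regionDeriv F e ((ℓ + 1) ^ k) Ωc Ac μ
                    *ᵥ ((regionOp F e hn (B1.aSeq a ((ℓ : ℝ) + 1) k) m2 Ωc Ac)⁻¹
                      *ᵥ (fun q : ↥(fineDom ((ℓ + 1) ^ k) Ωc) × ι => f (incl hn hsub q.1, q.2)))) x'
            - fld (regionDeriv F e ((ℓ + 1) ^ k) Ωc Ac μ
                    *ᵥ ((regionOp F e hn (B1.aSeq a ((ℓ : ℝ) + 1) k) m2 Ωc Ac)⁻¹
                      *ᵥ (fun q : ↥(fineDom ((ℓ + 1) ^ k) Ωc) × ι => f (incl hn hsub q.1, q.2)))) x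
            - (transport (fieldLink F (e / ((ℓ + 1) ^ k : ℕ)) (acBond Ωc Ac)) x l
                *ᵥ fld (regionDeriv F e ((ℓ + 1) ^ k) Ω₀c Ac μ
                      *ᵥ ((regionOp F e hn (B1.aSeq a ((ℓ : ℝ) + 1) k) m2 Ω₀c Ac)⁻¹ *ᵥ f)) (incl hn hsub x')
              - fld (regionDeriv F e ((ℓ + 1) ^ k) Ω₀c Ac μ
                      *ᵥ ((regionOp F e hn (B1.aSeq a ((ℓ : ℝ) + 1) k) m2 Ω₀c Ac)⁻¹ *ᵥ f)) (incl hn hsub x))) i|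
          ≤ c₀ * V * Real.exp (-((D + D₀ + D₁) / (2 * (((((ℓ + 1) ^ k : ℕ)) : ℝ) * K)))) * ‖f‖ := by
  classical
  obtain ⟨K₁, hK₁, h8₁, c₁, hc₁, H₁⟩ := thm112_holder_region F hℓ₁ hLip d ℓ hℓ amin aplus m2plus ha α hα0 hα1
  obtain ⟨K₂, hK₂, -, c₂, hc₂, H₂⟩ := thm112_deriv_region F hℓ₁ hLip d ℓ hℓ amin aplus m2plus ha
  set K : ℕ := K₁ * K₂ with hK
  have hK₂1 : 1 ≤ K₂ := le_trans (by norm_num) hK₂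
  have hK₁1 : 1 ≤ K₁ := le_trans (by norm_num) hK₁
  have hK₁K : K₁ ≤ K := by rw [hK]; nlinarith
  have hK₂K : K₂ ≤ K := by rw [hK]; nlinarith
  have hK₂K' : 16 * K₂ ≤ K := by rw [hK]; nlinarith
  have hK16 : 16 ≤ K := hK₁.trans hK₁K
  have h8 : 8 ∣ K := dvd_mul_of_dvd_left h8₁ K₂
  have hK₁r : (0 : ℝ) < K₁ := by exact_mod_cast lt_of_lt_of_le (by norm_num) hK₁
  have hK₂r : (0 : ℝ) < K₂ := by exact_mod_cast lt_of_lt_of_le (by norm_num) hK₂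
  have hKr : (0 : ℝ) < K := by exact_mod_cast lt_of_lt_of_le (by norm_num) hK16
  set c : ℝ := max c₁ (2 * (((Fintype.card ι : ℝ) + 1) * c₂)) with hc
  refine ⟨K, hK16, h8, c, lt_of_lt_of_le hc₁ (le_max_left _ _), fun creg β hcreg hβ => ?_⟩
  obtain ⟨e₁, he₁, H₁'⟩ := H₁ creg β hcreg hβ
  obtain ⟨e₂, he₂, H₂'⟩ := H₂ creg β hcreg hβ
  refine ⟨min e₁ e₂, lt_min he₁ he₂, ?_⟩
  intro k hk hn a m2 ea1 ea2 em1 em2 Ω₀c Ωc hΩ₀ hΩ hsub Ac e he hle h17 μ x x' hxμ hx'μ hne l hl hlend hlen hlnear hRx hRx'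
    P _ D D₀ D₁ hDsum hD hD' hD₀ hD₀' hD₁ f hfP V hV hfV i
  have hnr : (0 : ℝ) < (((ℓ + 1) ^ k : ℕ) : ℝ) := by exact_mod_cast hn
  have hV0 : (0 : ℝ) ≤ V := zero_le_one.trans hV
  -- the regions are unions of `K₁`-blocks and of `K₂`-blocks
  have hΩ₁ : IsBlockUnion K₁ Ωc := isBlockUnion_of_mul (K₂ := K₂) (by rw [← hK]; exact hΩ)
  have hΩ₂ : IsBlockUnion K₂ Ωc := isBlockUnion_of_mul (K₂ := K₁) (by rw [mul_comm, ← hK]; exact hΩ)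
  have hΩ₀₁ : IsBlockUnion K₁ Ω₀c := isBlockUnion_of_mul (K₂ := K₂) (by rw [← hK]; exact hΩ₀)
  have hΩ₀₂ : IsBlockUnion K₂ Ω₀c := isBlockUnion_of_mul (K₂ := K₁) (by rw [mul_comm, ← hK]; exact hΩ₀)
  -- the `R₀` restrictions of the two theorems
  have hR₁ : ∀ y : Fin (d + 1) → ℤ, (∀ ν, |y ν - blk ((ℓ + 1) ^ k) x.1 ν| ≤ (K₁ : ℤ) * (d + 4)) → y ∈ Ωc := by
    intro y hy
    refine hRx y fun ν => (hy ν).trans ?_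
    have : (K₁ : ℤ) ≤ K := by exact_mod_cast hK₁K
    nlinarith
  have hR₂ : ∀ (z : ↥(fineDom ((ℓ + 1) ^ k) Ωc)),
      (∀ y : Fin (d + 1) → ℤ, (∀ ν, |y ν - blk ((ℓ + 1) ^ k) z.1 ν| ≤ (K : ℤ) * (d + 4)) → y ∈ Ωc) →
      ∀ y : Fin (d + 1) → ℤ, (∀ ν, |y ν - blk ((ℓ + 1) ^ k) z.1 ν| ≤ (K₂ : ℤ) * (d + 3) + 1) → y ∈ Ωc := by
    intro z hz y hy
    refine hz y fun ν => (hy ν).trans ?_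
    have h1 : (16 : ℤ) * K₂ ≤ K := by exact_mod_cast hK₂K'
    have h2 : (1 : ℤ) ≤ K₂ := by exact_mod_cast hK₂1
    nlinarith
  -- `e^{−S/(2nKᵢ)} ≤ e^{−S/(2nK)}`
  have hexpK : ∀ K' : ℕ, (0 : ℝ) < K' → K' ≤ K →
      Real.exp (-((D + D₀ + D₁) / (2 * (((((ℓ + 1) ^ k : ℕ)) : ℝ) * K')))) ≤ Real.exp (-((D + D₀ + D₁) / (2 * (((((ℓ + 1) ^ k : ℕ)) : ℝ) * K)))) := by
    intro K' hK'0 hK'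
    refine Real.exp_le_exp.2 (neg_le_neg (div_le_div_of_nonneg_left hDsum (by positivity) ?_))
    exact mul_le_mul_of_nonneg_left (mul_le_mul_of_nonneg_left (by exact_mod_cast hK') hnr.le) zero_le_two
  have hrest : 0 ≤ V * Real.exp (-((D + D₀ + D₁) / (2 * (((((ℓ + 1) ^ k : ℕ)) : ℝ) * K)))) * ‖f‖ := by positivity
  by_cases hclose : 32 * supNorm (x'.1 - x.1) ≤ (((ℓ + 1) ^ k : ℕ) : ℝ) * K₁
  · -- close pairs
    have hb := H₁' k hk hn a m2 ea1 ea2 em1 em2 Ω₀c Ωc hΩ₀₁ hΩ₁ hsub Ac e he (hle.trans (min_le_left _ _)) h17 μ x x'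
      hxμ hx'μ hne hclose l hl hlend hlen hlnear hR₁ P D D₀ D₁ hD hD₀ hD₁ f hfP V hV hfV i
    refine hb.trans ?_
    calc c₁ * V * Real.exp (-((D + D₀ + D₁) / (2 * (((((ℓ + 1) ^ k : ℕ)) : ℝ) * K₁)))) * ‖f‖
        = c₁ * (V * Real.exp (-((D + D₀ + D₁) / (2 * (((((ℓ + 1) ^ k : ℕ)) : ℝ) * K₁)))) * ‖f‖) := by ring
      _ ≤ c * (V * Real.exp (-((D + D₀ + D₁) / (2 * (((((ℓ + 1) ^ k : ℕ)) : ℝ) * K)))) * ‖f‖) := by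
          refine mul_le_mul (le_max_left _ _) ?_ (by positivity) (hc₁.le.trans (le_max_left _ _))
          exact mul_le_mul_of_nonneg_right (mul_le_mul_of_nonneg_left (hexpK K₁ hK₁r hK₁K) hV0) (norm_nonneg _)
      _ = c * V * Real.exp (-((D + D₀ + D₁) / (2 * (((((ℓ + 1) ^ k : ℕ)) : ℝ) * K)))) * ‖f‖ := by ring
  · -- far pairs: Hölder weight `≤ 2`, derivative δG member at `x` and at `x′`
    set r : ℝ := supNorm (x'.1 - x.1) with hr
    have hr0 : 0 < r := lt_of_lt_of_le zero_lt_one (one_le_supNorm_of_ne hne)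
    have hw2 : ((((ℓ + 1) ^ k : ℕ) : ℝ) / r) ^ α ≤ 2 := by
      refine (rpow_le_max_one (div_nonneg hnr.le hr0.le) hα0 hα1.le).trans (max_le (by norm_num) ?_)
      rw [div_le_iff₀ hr0]
      have hK₁16 : (16 : ℝ) ≤ K₁ := by exact_mod_cast hK₁
      push Not at hclose
      nlinarith
    have hx1 := H₂' k hk hn a m2 ea1 ea2 em1 em2 Ω₀c Ωc hΩ₀₂ hΩ₂ hsub Ac e he (hle.trans (min_le_right _ _)) h17 μ x hxμ
      (hR₂ x hRx) P D D₀ D₁ hD hD₀ hD₁ f hfP V hV hfV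
    have hx2 := H₂' k hk hn a m2 ea1 ea2 em1 em2 Ω₀c Ωc hΩ₀₂ hΩ₂ hsub Ac e he (hle.trans (min_le_right _ _)) h17 μ x' hx'μ
      (hR₂ x' hRx') P D D₀ D₁ hD' hD₀' hD₁ f hfP V hV hfV
    set ΨΩ := regionDeriv F e ((ℓ + 1) ^ k) Ωc Ac μ
      *ᵥ ((regionOp F e hn (B1.aSeq a ((ℓ : ℝ) + 1) k) m2 Ωc Ac)⁻¹
        *ᵥ (fun q : ↥(fineDom ((ℓ + 1) ^ k) Ωc) × ι => f (incl hn hsub q.1, q.2))) with hΨΩ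
    set Ψ₀ := regionDeriv F e ((ℓ + 1) ^ k) Ω₀c Ac μ
      *ᵥ ((regionOp F e hn (B1.aSeq a ((ℓ : ℝ) + 1) k) m2 Ω₀c Ac)⁻¹ *ᵥ f) with hΨ₀
    -- the difference field `δ(z) = (D^ηu_Ω)(z) − (D^ηu₀)(z)` on `Ω`
    set δ : ↥(fineDom ((ℓ + 1) ^ k) Ωc) → ι → ℝ := fun z => fld ΨΩ z - fld Ψ₀ (incl hn hsub z) with hδ
    have hδ1 : ∀ k', |δ x k'| ≤ c₂ * V * Real.exp (-((D + D₀ + D₁) / (2 * (((((ℓ + 1) ^ k : ℕ)) : ℝ) * K₂)))) * ‖f‖ := fun k' => by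
      rw [hδ]; exact hx1 k'
    have hδ2 : ∀ k', |δ x' k'| ≤ c₂ * V * Real.exp (-((D + D₀ + D₁) / (2 * (((((ℓ + 1) ^ k : ℕ)) : ℝ) * K₂)))) * ‖f‖ := fun k' => by
      rw [hδ]; exact hx2 k'
    have hb0 : 0 ≤ c₂ * V * Real.exp (-((D + D₀ + D₁) / (2 * (((((ℓ + 1) ^ k : ℕ)) : ℝ) * K₂)))) * ‖f‖ := by positivity
    have hU : |(transport (fieldLink F (e / ((ℓ + 1) ^ k : ℕ)) (acBond Ωc Ac)) x l *ᵥ δ x') i|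
        ≤ (Fintype.card ι : ℝ) * (c₂ * V * Real.exp (-((D + D₀ + D₁) / (2 * (((((ℓ + 1) ^ k : ℕ)) : ℝ) * K₂)))) * ‖f‖) := by
      rw [transport_fieldLink]
      exact abs_U_mulVec_apply_le F _ _ hb0 (fun k' => hδ2 k') i
    have halg : transport (fieldLink F (e / ((ℓ + 1) ^ k : ℕ)) (acBond Ωc Ac)) x l *ᵥ fld ΨΩ x' - fld ΨΩ x
          - (transport (fieldLink F (e / ((ℓ + 1) ^ k : ℕ)) (acBond Ωc Ac)) x l *ᵥ fld Ψ₀ (incl hn hsub x')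
            - fld Ψ₀ (incl hn hsub x))
        = transport (fieldLink F (e / ((ℓ + 1) ^ k : ℕ)) (acBond Ωc Ac)) x l *ᵥ δ x' - δ x := by
      rw [hδ]
      simp only [Matrix.mulVec_sub]
      abel
    have hdiff : |(transport (fieldLink F (e / ((ℓ + 1) ^ k : ℕ)) (acBond Ωc Ac)) x l *ᵥ δ x' - δ x) i|
        ≤ ((Fintype.card ι : ℝ) + 1) * (c₂ * V * Real.exp (-((D + D₀ + D₁) / (2 * (((((ℓ + 1) ^ k : ℕ)) : ℝ) * K₂)))) * ‖f‖) := by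
      rw [Pi.sub_apply]
      refine (abs_sub _ _).trans ?_
      linarith [hδ1 i]
    have hw0 : 0 ≤ ((((ℓ + 1) ^ k : ℕ) : ℝ) / r) ^ α := Real.rpow_nonneg (div_nonneg hnr.le hr0.le) α
    rw [halg]
    calc ((((ℓ + 1) ^ k : ℕ) : ℝ) / r) ^ α
          * |(transport (fieldLink F (e / ((ℓ + 1) ^ k : ℕ)) (acBond Ωc Ac)) x l *ᵥ δ x' - δ x) i|
        ≤ 2 * (((Fintype.card ι : ℝ) + 1) * (c₂ * V * Real.exp (-((D + D₀ + D₁) / (2 * (((((ℓ + 1) ^ k : ℕ)) : ℝ) * K₂)))) * ‖f‖)) :=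
          mul_le_mul hw2 hdiff (abs_nonneg _) zero_le_two
      _ = 2 * (((Fintype.card ι : ℝ) + 1) * c₂) * (V * Real.exp (-((D + D₀ + D₁) / (2 * (((((ℓ + 1) ^ k : ℕ)) : ℝ) * K₂)))) * ‖f‖) := by
          ring
      _ ≤ c * (V * Real.exp (-((D + D₀ + D₁) / (2 * (((((ℓ + 1) ^ k : ℕ)) : ℝ) * K)))) * ‖f‖) := by
          refine mul_le_mul (le_max_right _ _) ?_ (by positivity) (hc₁.le.trans (le_max_left _ _))
          exact mul_le_mul_of_nonneg_right (mul_le_mul_of_nonneg_left (hexpK K₂ hK₂r hK₂K) hV0) (norm_nonneg _)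
      _ = c * V * Real.exp (-((D + D₀ + D₁) / (2 * (((((ℓ + 1) ^ k : ℕ)) : ℝ) * K)))) * ‖f‖ := by ring

/-! ## §2. «it is sufficient to prove the Proposition for a function f with support in a unit cube» (pp. 574–575) -/

/-- **(1.11)–(1.12), value member, GENERAL PAIR under `R₀`, FOR `f` SUPPORTED IN ONE UNIT BLOCK `B(y₀)` of `Ω₀`** («it is
sufficient to prove the Proposition for a function f with support in a unit cube», pp. 574–575; `‖f‖_{2,η} ≤ √N‖f‖_∞`):
`|(G_k(Ω,A)(f|_Ω))(x)_i − (G_k(Ω₀,A)f)(x)_i| ≤ c₀·exp(−(D+D₀+D₁)/(2nK))·‖f‖_∞`.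
[cite: Balaban1983RegularityDecay, Theorem p.573 (1.10)–(1.12), §2 ¶1 p.575] -/
theorem thm112_value_region_unitBlock (F : OrthFlow ι) {ℓ₁ : ℝ} (hℓ₁ : 0 ≤ ℓ₁)
    (hLip : ∀ t (v : ι → ℝ), ((F.U t - 1) *ᵥ v) ⬝ᵥ ((F.U t - 1) *ᵥ v) ≤ (ℓ₁ * t) ^ 2 * (v ⬝ᵥ v))
    (d ℓ : ℕ) (hℓ : 1 ≤ ℓ) (amin aplus m2plus : ℝ) (ha : 0 < amin) :
    ∃ K : ℕ, 8 ≤ K ∧ 8 ∣ K ∧ ∃ c₀ : ℝ, 0 < c₀ ∧ ∀ (creg β : ℝ), 0 ≤ creg → 0 < β →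
      ∃ e₁ : ℝ, 0 < e₁ ∧ ∀ (k : ℕ), 1 ≤ k → ∀ (hn : 1 ≤ (ℓ + 1) ^ k) (a m2 : ℝ),
      amin ≤ a → a ≤ aplus → 0 ≤ m2 → m2 ≤ m2plus →
      ∀ (Ω₀c Ωc : Finset (Fin (d + 1) → ℤ)), IsBlockUnion K Ω₀c → IsBlockUnion K Ωc → ∀ (hsub : Ωc ⊆ Ω₀c)
      (Ac : (Fin (d + 1) → ℤ) → Fin (d + 1) → ℝ) (e : ℝ), 0 < e → e ≤ e₁ →
        (∀ x ∈ fineDom ((ℓ + 1) ^ k) Ω₀c, ∀ μ ν : Fin (d + 1),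
          |Ac (x + e1 μ) ν - Ac x ν| ≤ creg * e ^ (β - 1) / ((ℓ + 1) ^ k : ℕ)) →
      ∀ (x : ↥(fineDom ((ℓ + 1) ^ k) Ωc)),
        (∀ y : Fin (d + 1) → ℤ, (∀ μ, |y μ - blk ((ℓ + 1) ^ k) x.1 μ| ≤ (K : ℤ) * (d + 3)) → y ∈ Ωc) →
      ∀ (y₀ : Fin (d + 1) → ℤ) (D D₀ D₁ : ℝ),
        (∀ x' : ↥(fineDom ((ℓ + 1) ^ k) Ω₀c), blk ((ℓ + 1) ^ k) x'.1 = y₀ → ∃ μ, D ≤ |rpos ((ℓ + 1) ^ k) Ω₀c (incl hn hsub x) μ - rpos ((ℓ + 1) ^ k) Ω₀c x' μ|) →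
        (∀ x₁ : ↥(fineDom ((ℓ + 1) ^ k) Ω₀c), ¬ inReg ((ℓ + 1) ^ k) Ωc x₁ →
          ∃ μ, D₀ ≤ |rpos ((ℓ + 1) ^ k) Ω₀c (incl hn hsub x) μ - rpos ((ℓ + 1) ^ k) Ω₀c x₁ μ|) →
        (∀ x' : ↥(fineDom ((ℓ + 1) ^ k) Ω₀c), blk ((ℓ + 1) ^ k) x'.1 = y₀ → ∀ x₁ : ↥(fineDom ((ℓ + 1) ^ k) Ω₀c), ¬ inReg ((ℓ + 1) ^ k) Ωc x₁ →
          ∃ μ, D₁ ≤ |rpos ((ℓ + 1) ^ k) Ω₀c x₁ μ - rpos ((ℓ + 1) ^ k) Ω₀c x' μ|) →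
      ∀ (f : ↥(fineDom ((ℓ + 1) ^ k) Ω₀c) × ι → ℝ), (∀ p, blk ((ℓ + 1) ^ k) p.1.1 ≠ y₀ → f p = 0) →
      ∀ i : ι,
        |((regionOp F e hn (B1.aSeq a ((ℓ : ℝ) + 1) k) m2 Ωc Ac)⁻¹
              *ᵥ (fun q : ↥(fineDom ((ℓ + 1) ^ k) Ωc) × ι => f (incl hn hsub q.1, q.2))) (x, i)
          - ((regionOp F e hn (B1.aSeq a ((ℓ : ℝ) + 1) k) m2 Ω₀c Ac)⁻¹ *ᵥ f) (incl hn hsub x, i)|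
          ≤ c₀ * Real.exp (-((D + D₀ + D₁) / (2 * ((((ℓ + 1) ^ k : ℕ) : ℝ) * K)))) * ‖f‖  := by
  classical
  obtain ⟨K, hK8, h8, c₀, hc₀, H⟩ := thm112_value_region F hℓ₁ hLip d ℓ hℓ amin aplus m2plus ha
  refine ⟨K, hK8, h8, c₀ * max (Real.sqrt (Fintype.card ι)) 1, by positivity, fun creg β hcreg hβ => ?_⟩
  obtain ⟨e₁, he₁, H'⟩ := H creg β hcreg hβ
  refine ⟨e₁, he₁, ?_⟩
  intro k hk hn a m2 ea1 ea2 em1 em2 Ω₀c Ωc hΩ₀ hΩ hsub Ac e he hle h17 x hxR y₀ D D₀ D₁ hD hD₀ hD₁ f hf i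
  have hV : (1 : ℝ) ≤ max (Real.sqrt (Fintype.card ι)) 1 := le_max_right _ _
  have hfV : lpv (vol d ℓ k)⁻¹ 2 f ≤ max (Real.sqrt (Fintype.card ι)) 1 * ‖f‖ :=
    (lpv_two_le_unitBlock hn y₀ f hf).trans (mul_le_mul_of_nonneg_right (le_max_left _ _) (norm_nonneg f))
  have h := H' k hk hn a m2 ea1 ea2 em1 em2 Ω₀c Ωc hΩ₀ hΩ hsub Ac e he hle h17 x hxR
    (fun x' => blk ((ℓ + 1) ^ k) x'.1 = y₀) D D₀ D₁ hD hD₀ hD₁ f (fun p hp => hf p hp) _ hV hfV i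
  refine h.trans (le_of_eq ?_)
  ring

/-- **(1.11)–(1.12), derivative member, GENERAL PAIR under `R₀`, FOR `f` SUPPORTED IN ONE UNIT BLOCK `B(y₀)` of `Ω₀`**:
`|(D^η_{A,μ}G_k(Ω,A)(f|_Ω))(x)_i − (D^η_{A,μ}G_k(Ω₀,A)f)(x)_i| ≤ c₀·exp(−(D+D₀+D₁)/(2nK))·‖f‖_∞`.
[cite: Balaban1983RegularityDecay, Theorem p.573 (1.10)–(1.12), §2 ¶1 p.575] -/
theorem thm112_deriv_region_unitBlock (F : OrthFlow ι) {ℓ₁ : ℝ} (hℓ₁ : 0 ≤ ℓ₁)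
    (hLip : ∀ t (v : ι → ℝ), ((F.U t - 1) *ᵥ v) ⬝ᵥ ((F.U t - 1) *ᵥ v) ≤ (ℓ₁ * t) ^ 2 * (v ⬝ᵥ v))
    (d ℓ : ℕ) (hℓ : 1 ≤ ℓ) (amin aplus m2plus : ℝ) (ha : 0 < amin) :
    ∃ K : ℕ, 8 ≤ K ∧ 8 ∣ K ∧ ∃ c₀ : ℝ, 0 < c₀ ∧ ∀ (creg β : ℝ), 0 ≤ creg → 0 < β →
      ∃ e₁ : ℝ, 0 < e₁ ∧ ∀ (k : ℕ), 1 ≤ k → ∀ (hn : 1 ≤ (ℓ + 1) ^ k) (a m2 : ℝ),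
      amin ≤ a → a ≤ aplus → 0 ≤ m2 → m2 ≤ m2plus →
      ∀ (Ω₀c Ωc : Finset (Fin (d + 1) → ℤ)), IsBlockUnion K Ω₀c → IsBlockUnion K Ωc → ∀ (hsub : Ωc ⊆ Ω₀c)
      (Ac : (Fin (d + 1) → ℤ) → Fin (d + 1) → ℝ) (e : ℝ), 0 < e → e ≤ e₁ →
        (∀ x ∈ fineDom ((ℓ + 1) ^ k) Ω₀c, ∀ μ ν : Fin (d + 1),
          |Ac (x + e1 μ) ν - Ac x ν| ≤ creg * e ^ (β - 1) / ((ℓ + 1) ^ k : ℕ)) →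
      ∀ (μ : Fin (d + 1)) (x : ↥(fineDom ((ℓ + 1) ^ k) Ωc)), x.1 + e1 μ ∈ fineDom ((ℓ + 1) ^ k) Ωc →
        (∀ y : Fin (d + 1) → ℤ, (∀ ν, |y ν - blk ((ℓ + 1) ^ k) x.1 ν| ≤ (K : ℤ) * (d + 3) + 1) → y ∈ Ωc) →
      ∀ (y₀ : Fin (d + 1) → ℤ) (D D₀ D₁ : ℝ),
        (∀ x' : ↥(fineDom ((ℓ + 1) ^ k) Ω₀c), blk ((ℓ + 1) ^ k) x'.1 = y₀ → ∃ μ, D ≤ |rpos ((ℓ + 1) ^ k) Ω₀c (incl hn hsub x) μ - rpos ((ℓ + 1) ^ k) Ω₀c x' μ|) →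
        (∀ x₁ : ↥(fineDom ((ℓ + 1) ^ k) Ω₀c), ¬ inReg ((ℓ + 1) ^ k) Ωc x₁ →
          ∃ μ, D₀ ≤ |rpos ((ℓ + 1) ^ k) Ω₀c (incl hn hsub x) μ - rpos ((ℓ + 1) ^ k) Ω₀c x₁ μ|) →
        (∀ x' : ↥(fineDom ((ℓ + 1) ^ k) Ω₀c), blk ((ℓ + 1) ^ k) x'.1 = y₀ → ∀ x₁ : ↥(fineDom ((ℓ + 1) ^ k) Ω₀c), ¬ inReg ((ℓ + 1) ^ k) Ωc x₁ →
          ∃ μ, D₁ ≤ |rpos ((ℓ + 1) ^ k) Ω₀c x₁ μ - rpos ((ℓ + 1) ^ k) Ω₀c x' μ|) →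
      ∀ (f : ↥(fineDom ((ℓ + 1) ^ k) Ω₀c) × ι → ℝ), (∀ p, blk ((ℓ + 1) ^ k) p.1.1 ≠ y₀ → f p = 0) →
      ∀ i : ι,
        |(regionDeriv F e ((ℓ + 1) ^ k) Ωc Ac μ
              *ᵥ ((regionOp F e hn (B1.aSeq a ((ℓ : ℝ) + 1) k) m2 Ωc Ac)⁻¹
                *ᵥ (fun q : ↥(fineDom ((ℓ + 1) ^ k) Ωc) × ι => f (incl hn hsub q.1, q.2)))) (x, i)
          - (regionDeriv F e ((ℓ + 1) ^ k) Ω₀c Ac μ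
              *ᵥ ((regionOp F e hn (B1.aSeq a ((ℓ : ℝ) + 1) k) m2 Ω₀c Ac)⁻¹ *ᵥ f)) (incl hn hsub x, i)|
          ≤ c₀ * Real.exp (-((D + D₀ + D₁) / (2 * ((((ℓ + 1) ^ k : ℕ) : ℝ) * K)))) * ‖f‖  := by
  classical
  obtain ⟨K, hK8, h8, c₀, hc₀, H⟩ := thm112_deriv_region F hℓ₁ hLip d ℓ hℓ amin aplus m2plus ha
  refine ⟨K, hK8, h8, c₀ * max (Real.sqrt (Fintype.card ι)) 1, by positivity, fun creg β hcreg hβ => ?_⟩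
  obtain ⟨e₁, he₁, H'⟩ := H creg β hcreg hβ
  refine ⟨e₁, he₁, ?_⟩
  intro k hk hn a m2 ea1 ea2 em1 em2 Ω₀c Ωc hΩ₀ hΩ hsub Ac e he hle h17 μ x hxμ hxR y₀ D D₀ D₁ hD hD₀ hD₁ f hf i
  have hV : (1 : ℝ) ≤ max (Real.sqrt (Fintype.card ι)) 1 := le_max_right _ _
  have hfV : lpv (vol d ℓ k)⁻¹ 2 f ≤ max (Real.sqrt (Fintype.card ι)) 1 * ‖f‖ :=
    (lpv_two_le_unitBlock hn y₀ f hf).trans (mul_le_mul_of_nonneg_right (le_max_left _ _) (norm_nonneg f))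
  have h := H' k hk hn a m2 ea1 ea2 em1 em2 Ω₀c Ωc hΩ₀ hΩ hsub Ac e he hle h17 μ x hxμ hxR
    (fun x' => blk ((ℓ + 1) ^ k) x'.1 = y₀) D D₀ D₁ hD hD₀ hD₁ f (fun p hp => hf p hp) _ hV hfV i
  refine h.trans (le_of_eq ?_)
  ring

/-- **(1.11)–(1.12), Hölder member, GENERAL PAIR under `R₀`, ALL PAIRS, FOR `f` SUPPORTED IN ONE UNIT BLOCK `B(y₀)` of `Ω₀`**:
`(η^{-1}/|x−x′|_∞)^α·|(U(D^ηu_Ω)(x′) − (D^ηu_Ω)(x) − (U(D^ηu₀)(x′) − (D^ηu₀)(x)))_i| ≤ c₀·exp(−(D+D₀+D₁)/(2nK))·‖f‖_∞`.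
[cite: Balaban1983RegularityDecay, Theorem p.573 (1.9)–(1.12), §2 ¶1 p.575] -/
theorem thm112_holder_region_all_unitBlock (F : OrthFlow ι) {ℓ₁ : ℝ} (hℓ₁ : 0 ≤ ℓ₁)
    (hLip : ∀ t (v : ι → ℝ), ((F.U t - 1) *ᵥ v) ⬝ᵥ ((F.U t - 1) *ᵥ v) ≤ (ℓ₁ * t) ^ 2 * (v ⬝ᵥ v))
    (d ℓ : ℕ) (hℓ : 1 ≤ ℓ) (amin aplus m2plus : ℝ) (ha : 0 < amin) (α : ℝ) (hα0 : 0 ≤ α) (hα1 : α < 1) :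
    ∃ K : ℕ, 16 ≤ K ∧ 8 ∣ K ∧ ∃ c₀ : ℝ, 0 < c₀ ∧ ∀ (creg β : ℝ), 0 ≤ creg → 0 < β →
      ∃ e₁ : ℝ, 0 < e₁ ∧ ∀ (k : ℕ), 1 ≤ k → ∀ (hn : 1 ≤ (ℓ + 1) ^ k) (a m2 : ℝ),
      amin ≤ a → a ≤ aplus → 0 ≤ m2 → m2 ≤ m2plus →
      ∀ (Ω₀c Ωc : Finset (Fin (d + 1) → ℤ)), IsBlockUnion K Ω₀c → IsBlockUnion K Ωc → ∀ (hsub : Ωc ⊆ Ω₀c)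
      (Ac : (Fin (d + 1) → ℤ) → Fin (d + 1) → ℝ) (e : ℝ), 0 < e → e ≤ e₁ →
        (∀ x ∈ fineDom ((ℓ + 1) ^ k) Ω₀c, ∀ μ ν : Fin (d + 1),
          |Ac (x + e1 μ) ν - Ac x ν| ≤ creg * e ^ (β - 1) / ((ℓ + 1) ^ k : ℕ)) →
      ∀ (μ : Fin (d + 1)) (x x' : ↥(fineDom ((ℓ + 1) ^ k) Ωc)), x.1 + e1 μ ∈ fineDom ((ℓ + 1) ^ k) Ωc →
        x'.1 + e1 μ ∈ fineDom ((ℓ + 1) ^ k) Ωc → x'.1 ≠ x.1 →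
      ∀ (l : List ↥(fineDom ((ℓ + 1) ^ k) Ωc)), IsNNChain x l → pathEnd x l = x' →
        (l.length : ℝ) ≤ ((d : ℝ) + 1) * supNorm (x'.1 - x.1) →
        (∀ z ∈ l, supNorm (z.1 - x.1) ≤ supNorm (x'.1 - x.1)) →
        (∀ y : Fin (d + 1) → ℤ, (∀ ν, |y ν - blk ((ℓ + 1) ^ k) x.1 ν| ≤ (K : ℤ) * (d + 4)) → y ∈ Ωc) →
        (∀ y : Fin (d + 1) → ℤ, (∀ ν, |y ν - blk ((ℓ + 1) ^ k) x'.1 ν| ≤ (K : ℤ) * (d + 4)) → y ∈ Ωc) →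
      ∀ (y₀ : Fin (d + 1) → ℤ) (D D₀ D₁ : ℝ), 0 ≤ D + D₀ + D₁ →
        (∀ x'' : ↥(fineDom ((ℓ + 1) ^ k) Ω₀c), blk ((ℓ + 1) ^ k) x''.1 = y₀ → ∃ ν, D ≤ |rpos ((ℓ + 1) ^ k) Ω₀c (incl hn hsub x) ν - rpos ((ℓ + 1) ^ k) Ω₀c x'' ν|) →
        (∀ x'' : ↥(fineDom ((ℓ + 1) ^ k) Ω₀c), blk ((ℓ + 1) ^ k) x''.1 = y₀ → ∃ ν, D ≤ |rpos ((ℓ + 1) ^ k) Ω₀c (incl hn hsub x') ν - rpos ((ℓ + 1) ^ k) Ω₀c x'' ν|) →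
        (∀ x₁ : ↥(fineDom ((ℓ + 1) ^ k) Ω₀c), ¬ inReg ((ℓ + 1) ^ k) Ωc x₁ →
          ∃ ν, D₀ ≤ |rpos ((ℓ + 1) ^ k) Ω₀c (incl hn hsub x) ν - rpos ((ℓ + 1) ^ k) Ω₀c x₁ ν|) →
        (∀ x₁ : ↥(fineDom ((ℓ + 1) ^ k) Ω₀c), ¬ inReg ((ℓ + 1) ^ k) Ωc x₁ →
          ∃ ν, D₀ ≤ |rpos ((ℓ + 1) ^ k) Ω₀c (incl hn hsub x') ν - rpos ((ℓ + 1) ^ k) Ω₀c x₁ ν|) →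
        (∀ x'' : ↥(fineDom ((ℓ + 1) ^ k) Ω₀c), blk ((ℓ + 1) ^ k) x''.1 = y₀ → ∀ x₁ : ↥(fineDom ((ℓ + 1) ^ k) Ω₀c), ¬ inReg ((ℓ + 1) ^ k) Ωc x₁ →
          ∃ ν, D₁ ≤ |rpos ((ℓ + 1) ^ k) Ω₀c x₁ ν - rpos ((ℓ + 1) ^ k) Ω₀c x'' ν|) →
      ∀ (f : ↥(fineDom ((ℓ + 1) ^ k) Ω₀c) × ι → ℝ), (∀ p, blk ((ℓ + 1) ^ k) p.1.1 ≠ y₀ → f p = 0) →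
      ∀ i : ι,
        ((((ℓ + 1) ^ k : ℕ) : ℝ) / supNorm (x'.1 - x.1)) ^ α *
          |(transport (fieldLink F (e / ((ℓ + 1) ^ k : ℕ)) (acBond Ωc Ac)) x l
              *ᵥ fld (regionDeriv F e ((ℓ + 1) ^ k) Ωc Ac μ
                    *ᵥ ((regionOp F e hn (B1.aSeq a ((ℓ : ℝ) + 1) k) m2 Ωc Ac)⁻¹
                      *ᵥ (fun q : ↥(fineDom ((ℓ + 1) ^ k) Ωc) × ι => f (incl hn hsub q.1, q.2)))) x'
            - fld (regionDeriv F e ((ℓ + 1) ^ k) Ωc Ac μ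
                    *ᵥ ((regionOp F e hn (B1.aSeq a ((ℓ : ℝ) + 1) k) m2 Ωc Ac)⁻¹
                      *ᵥ (fun q : ↥(fineDom ((ℓ + 1) ^ k) Ωc) × ι => f (incl hn hsub q.1, q.2)))) x
            - (transport (fieldLink F (e / ((ℓ + 1) ^ k : ℕ)) (acBond Ωc Ac)) x l
                *ᵥ fld (regionDeriv F e ((ℓ + 1) ^ k) Ω₀c Ac μ
                      *ᵥ ((regionOp F e hn (B1.aSeq a ((ℓ : ℝ) + 1) k) m2 Ω₀c Ac)⁻¹ *ᵥ f)) (incl hn hsub x')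
              - fld (regionDeriv F e ((ℓ + 1) ^ k) Ω₀c Ac μ
                      *ᵥ ((regionOp F e hn (B1.aSeq a ((ℓ : ℝ) + 1) k) m2 Ω₀c Ac)⁻¹ *ᵥ f)) (incl hn hsub x))) i|
          ≤ c₀ * Real.exp (-((D + D₀ + D₁) / (2 * (((((ℓ + 1) ^ k : ℕ)) : ℝ) * K)))) * ‖f‖  := by
  classical
  obtain ⟨K, hK16, h8, c₀, hc₀, H⟩ := thm112_holder_region_all F hℓ₁ hLip d ℓ hℓ amin aplus m2plus ha α hα0 hα1
  refine ⟨K, hK16, h8, c₀ * max (Real.sqrt (Fintype.card ι)) 1, by positivity, fun creg β hcreg hβ => ?_⟩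
  obtain ⟨e₁, he₁, H'⟩ := H creg β hcreg hβ
  refine ⟨e₁, he₁, ?_⟩
  intro k hk hn a m2 ea1 ea2 em1 em2 Ω₀c Ωc hΩ₀ hΩ hsub Ac e he hle h17 μ x x' hxμ hx'μ hne l hl hlend hlen hlnear hRx hRx' y₀ D D₀ D₁ hDsum hD hD' hD₀ hD₀' hD₁ f hf i
  have hV : (1 : ℝ) ≤ max (Real.sqrt (Fintype.card ι)) 1 := le_max_right _ _
  have hfV : lpv (vol d ℓ k)⁻¹ 2 f ≤ max (Real.sqrt (Fintype.card ι)) 1 * ‖f‖ :=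
    (lpv_two_le_unitBlock hn y₀ f hf).trans (mul_le_mul_of_nonneg_right (le_max_left _ _) (norm_nonneg f))
  have h := H' k hk hn a m2 ea1 ea2 em1 em2 Ω₀c Ωc hΩ₀ hΩ hsub Ac e he hle h17 μ x x' hxμ hx'μ hne l hl hlend hlen
    hlnear hRx hRx' (fun x'' => blk ((ℓ + 1) ^ k) x''.1 = y₀) D D₀ D₁ hDsum hD hD' hD₀ hD₀' hD₁ f (fun p hp => hf p hp) _ hV hfV i
  refine h.trans (le_of_eq ?_)
  ring

end

end Literature.MathematicalPhysics.QuantumFieldTheory.Balaban1983to89.B4Thm112RegionLpHolderAll
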